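import Mathlib.FieldTheory.Finite.Basic
import Literature.NumberTheory.Automorphic.AdicCompletionCompact
import Literature.NumberTheory.QuadraticForms.HilbertSymbol
import Literature.RingTheory.DiscreteValuationRing.AdicCompletionHensel
import HarnessLib

/-!
# The Hilbert symbol at a non-dyadic place: Hensel's lemma for squares and the
# non-dyadic case of O'Meara 63:13

Topic `NumberTheory/QuadraticForms`; namespace `Literature`; all declarations fully proved.

For a number field `K` and a finite place `v`, write `K_v = v.adicCompletion K`, `𝒪_v = 𝒪[K_v]`,
`𝓂_v`, `𝓀_v` for its ring of integers, maximal ideal and (finite) residue field.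

* `isSquare_of_isSquare_residue` : **Hensel's lemma for squares** at a non-dyadic place
  (`2 ∈ 𝒪_vˣ`): a unit of `𝒪_v` whose residue is a square is a square (O'Meara 63:1, the Local
  Square Theorem, in its simplest non-dyadic form; Hensel's lemma for `𝒪_v` is the instance
  `adicCompletionIntegers.henselianLocalRing` of
  `Literature/RingTheory/DiscreteValuationRing/AdicCompletionHensel.lean`).
* `hilbertSymbol_eq_neg_one_of_not_isSquare_residue_of_odd` : if `ε ∈ 𝒪_vˣ` has non-square
  residue and `ϖ` has odd valuation then `(ε, ϖ)_v = -1` (valuations of `ε x²` and `ϖ y²` have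
  different parity, so `ε x² + ϖ y² = 1` forces `ε x² ≡ 1 (mod 𝓂_v)`); O'Meara 63:11a /
  Example 63:12 (`(π, δ)_𝔭 = 1` iff the unit `δ` is a square, at a non-dyadic `𝔭`).
* `adicCompletion_exists_hilbertSymbol_eq_neg_one_of_not_mem` : **O'Meara 63:13 at a non-dyadic
  place** — if `2 ∉ v` then for every non-square `β ∈ K_vˣ` there is `α ∈ K_vˣ` with
  `(α, β)_v = -1`: `α` = a unit with non-square residue if `v(β)` is odd, `α` = a uniformiser if
  `v(β)` is even (then `β = u·c²` with `u` a unit of non-square residue, by Hensel). This proves the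
  non-dyadic part of the named fact `adicCompletion_exists_hilbertSymbol_eq_neg_one`
  (`QuadraticNormIndex.lean`); the dyadic places need O'Meara's analysis of the quadratic defect
  (§63A) and are not treated here.
* `hilbertSymbol_eq_one_of_isUnit` : at a non-dyadic place local units have trivial symbol,
  `(u₁, u₂)_v = 1` for `u₁ u₂ ∈ 𝒪_vˣ` (a solution of `ū₁ x² + ū₂ y² = 1` in the finite residue
  field, lifted by Hensel; O'Meara 62:1 and Example 63:12). The case of global units
  `a b ∈ 𝓞 K ∖ v` and its consequence, the finiteness of the set of places with `(a, b)_v = -1`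
  (first assertion of O'Meara 71:18), are `hilbertSymbol_eq_one_of_not_mem` and
  `finite_setOf_hilbertSymbol_eq_neg_one` of `HilbertReciprocityFiniteness.lean` (which also
  provides `hilbertSymbol_mul_sq_left/right`, the dependence of the symbol on square classes
  only).

## References

* O. T. O'Meara, *Introduction to quadratic forms*, Grundlehren 117, Springer (1963), §62
  (62:1), §63 (63:1 Local Square Theorem, 63:11a, Example 63:12, 63:13), §71 (71:18).
* J.-P. Serre, *A course in arithmetic*, GTM 7 (1973), Ch. II §3.3 and Ch. III §1.2 Thm. 1 (the
  case `K = ℚ`).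
-/

noncomputable section

open NumberField IsDedekindDomain Valued

namespace Literature.NumberTheory.QuadraticForms

variable (K : Type*) [Field K] [NumberField K] (v : HeightOneSpectrum (𝓞 K))

/-! ### Units of `𝒪_v` and Hensel's lemma for squares -/

/-- Membership in `𝓂_v` is `v(·) < 1`. [folklore] -/
theorem mem_maximalIdeal_integer_iff (z : 𝒪[v.adicCompletion K]) :
    z ∈ 𝓂[v.adicCompletion K] ↔ Valued.v (z : v.adicCompletion K) < 1 := by
  rw [Valued.maximalIdeal, IsLocalRing.mem_maximalIdeal, mem_nonunits_iff]
  exact Valuation.Integer.not_isUnit_iff_valuation_lt_one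

/-- A local integer is a unit iff its valuation is `1`. [folklore] -/
theorem isUnit_integer_iff (z : 𝒪[v.adicCompletion K]) :
    IsUnit z ↔ Valued.v (z : v.adicCompletion K) = 1 := by
  rw [← not_iff_not, Valuation.Integer.not_isUnit_iff_valuation_lt_one]
  exact ⟨fun h ↦ h.ne, fun h ↦ lt_of_le_of_ne z.2 h⟩

open Polynomial in
/-- **Hensel's lemma for squares at a non-dyadic place**: if `2` is a unit of `𝒪_v`, a unit
`u ∈ 𝒪_v` whose residue is a square in `𝓀_v` is a square in `𝒪_v` (lift a root of `X² - u`,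
simple since `2ū ≠ 0`; O'Meara 63:1 / 63:1a in the non-dyadic case, Serre, *Cours
d'arithmétique*, II §3.3). [folklore] -/
theorem isSquare_of_isSquare_residue (h2 : IsUnit (2 : 𝒪[v.adicCompletion K]))
    {u : 𝒪[v.adicCompletion K]} (hu : IsUnit u)
    (hsq : IsSquare (IsLocalRing.residue 𝒪[v.adicCompletion K] u)) : IsSquare u := by
  haveI : HenselianLocalRing 𝒪[v.adicCompletion K] :=
    inferInstanceAs (HenselianLocalRing (v.adicCompletionIntegers K))
  obtain ⟨r₀, hr₀⟩ := hsq
  obtain ⟨a₀, rfl⟩ := IsLocalRing.residue_surjective r₀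
  have hmonic : (X ^ 2 - C u : (𝒪[v.adicCompletion K])[X]).Monic :=
    monic_X_pow_sub_C u two_ne_zero
  have heval : ∀ a : 𝒪[v.adicCompletion K], (X ^ 2 - C u).eval a = a ^ 2 - u := fun a ↦ by
    simp
  -- `a₀² - u ∈ 𝓂_v`
  have h1 : (X ^ 2 - C u).eval a₀ ∈ 𝓂[v.adicCompletion K] := by
    rw [heval, Valued.maximalIdeal, ← IsLocalRing.residue_eq_zero_iff, map_sub, map_pow, hr₀, sq,
      sub_self]
  -- `2 a₀` is a unit
  have h2a : IsUnit ((derivative (X ^ 2 - C u : (𝒪[v.adicCompletion K])[X])).eval a₀) := by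
    have hder : (derivative (X ^ 2 - C u : (𝒪[v.adicCompletion K])[X])).eval a₀ = 2 * a₀ := by
      norm_num
    rw [hder]
    have hu0 : IsLocalRing.residue 𝒪[v.adicCompletion K] u ≠ 0 := by
      rw [Ne, IsLocalRing.residue_eq_zero_iff, IsLocalRing.mem_maximalIdeal, mem_nonunits_iff]
      exact fun h ↦ h hu
    have ha0 : IsUnit a₀ := by
      by_contra h0
      have h0' : IsLocalRing.residue 𝒪[v.adicCompletion K] a₀ = 0 := by
        rw [IsLocalRing.residue_eq_zero_iff, IsLocalRing.mem_maximalIdeal, mem_nonunits_iff]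
        exact h0
      rw [h0', mul_zero] at hr₀
      exact hu0 hr₀
    exact h2.mul ha0
  obtain ⟨a, ha, -⟩ := HenselianLocalRing.is_henselian (X ^ 2 - C u) hmonic a₀ h1 h2a
  refine ⟨a, ?_⟩
  have h := ha.eq_zero
  rw [heval, sub_eq_zero] at h
  rw [← h, sq]

/-- `log v(z²) = 2 log v(z)` for the `ℤᵐ⁰`-valued valuation of `K_v` (also for `z = 0`, both sides
being `0`). [folklore] -/
theorem log_valuation_sq (z : v.adicCompletion K) :
    WithZero.log (Valued.v (z ^ 2)) = 2 * WithZero.log (Valued.v z) := by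
  rw [map_pow, WithZero.log_pow, nsmul_eq_mul, Nat.cast_ofNat]

/-! ### The tame symbol `(ε, ϖ)_v = -1` -/

/-- If `ε ∈ 𝒪_vˣ` has non-square residue and `ϖ ∈ K_v` has odd valuation, the equation
`ε x² + ϖ y² = 1` has no solution in `K_v`, i.e. `(ε, ϖ)_v = -1`: `v(ε x²)` is even and
`v(ϖ y²)` odd, so `1 = v(ε x² + ϖ y²) = max` forces `v(x) = 0` and `ϖ y² ∈ 𝓂_v`, whence
`ε̄ x̄² = 1` in `𝓀_v` and `ε̄` would be a square (O'Meara 63:11a, `(π, Δ)_𝔭 = -1`, and Example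
63:12: at a non-dyadic `𝔭`, `(π, δ)_𝔭 = 1` iff the unit `δ` is a square; no assumption on the
residue characteristic is needed for this direction).
[cite: Omeara1963, §63B Cor. 63:11a and Example 63:12] -/
theorem hilbertSymbol_eq_neg_one_of_not_isSquare_residue_of_odd {ε : 𝒪[v.adicCompletion K]}
    (hε : ¬ IsSquare (IsLocalRing.residue 𝒪[v.adicCompletion K] ε)) {ϖ : v.adicCompletion K}
    (hϖ : Odd (WithZero.log (Valued.v ϖ))) :
    hilbertSymbol (v.adicCompletion K) (ε : v.adicCompletion K) ϖ = -1 := by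
  rw [hilbertSymbol_eq_neg_one_iff]
  rintro ⟨x, y, hxy⟩
  -- `ε` is a unit: its residue is non-zero (a non-square)
  have hεu : IsUnit ε := by
    by_contra h
    apply hε
    have h0 : IsLocalRing.residue 𝒪[v.adicCompletion K] ε = 0 := by
      rw [IsLocalRing.residue_eq_zero_iff, IsLocalRing.mem_maximalIdeal, mem_nonunits_iff]
      exact h
    rw [h0]
    exact IsSquare.zero
  have hε1 : Valued.v (ε : v.adicCompletion K) = 1 := (isUnit_integer_iff K v ε).1 hεu
  have hϖ0 : ϖ ≠ 0 := by
    rintro rfl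
    rw [map_zero, WithZero.log_zero] at hϖ
    exact (Int.not_odd_iff_even.2 Even.zero) hϖ
  have hvϖ : Valued.v ϖ ≠ 0 := (Valuation.ne_zero_iff Valued.v).2 hϖ0
  -- parities of `v(ϖ z²)` (odd) and `v(ε z²)` (even)
  have hodd : ∀ z : v.adicCompletion K, z ≠ 0 →
      Odd (WithZero.log (Valued.v (ϖ * z ^ 2))) := fun z hz ↦ by
    have hvz : Valued.v (z ^ 2) ≠ 0 := (Valuation.ne_zero_iff Valued.v).2 (pow_ne_zero 2 hz)
    rw [map_mul, WithZero.log_mul hvϖ hvz, log_valuation_sq]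
    obtain ⟨m, hm⟩ := hϖ
    exact ⟨m + WithZero.log (Valued.v z), by rw [hm]; ring⟩
  have heven : ∀ z : v.adicCompletion K,
      Even (WithZero.log (Valued.v ((ε : v.adicCompletion K) * z ^ 2))) := fun z ↦ by
    rw [map_mul, hε1, one_mul, log_valuation_sq]
    exact even_two_mul _
  -- Step 1: `v(ε x²) = 1` and `v(ϖ y²) < 1`
  have hkey : Valued.v ((ε : v.adicCompletion K) * x ^ 2) = 1 ∧ Valued.v (ϖ * y ^ 2) < 1 := by
    by_cases hy : y = 0
    · subst hy
      have h : (ε : v.adicCompletion K) * x ^ 2 = 1 := by simpa using hxy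
      exact ⟨by rw [h, map_one], by simp⟩
    · have hne1 : Valued.v (ϖ * y ^ 2) ≠ 1 := fun h ↦
        Int.not_even_iff_odd.2 (hodd y hy) (by rw [h, WithZero.log_one]; exact Even.zero)
      have hne : Valued.v ((ε : v.adicCompletion K) * x ^ 2) ≠ Valued.v (ϖ * y ^ 2) := fun h ↦
        Int.not_even_iff_odd.2 (hodd y hy) (h ▸ heven x)
      have hmax := Valuation.map_add_of_distinct_val Valued.v hne
      rw [hxy, map_one] at hmax
      rcases max_eq_iff.1 hmax.symm with ⟨ha, hb⟩ | ⟨hb, -⟩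
      · exact ⟨ha, lt_of_le_of_ne (hb.trans ha.le) hne1⟩
      · exact absurd hb hne1
  obtain ⟨hεx, hlt⟩ := hkey
  -- Step 2: `x` is a unit of `𝒪_v`
  have hx1 : Valued.v x = 1 := by
    rw [map_mul, hε1, one_mul] at hεx
    have hx0 : Valued.v x ≠ 0 := fun h0 ↦ by
      rw [map_pow, h0, zero_pow two_ne_zero] at hεx
      exact zero_ne_one hεx
    have hl := congr_arg WithZero.log hεx
    rw [log_valuation_sq, WithZero.log_one] at hl
    rw [← WithZero.exp_log hx0, show WithZero.log (Valued.v x) = 0 by omega, WithZero.exp_zero]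
  -- Step 3: reduce `ε x² = 1 - ϖ y²` modulo `𝓂_v`
  let x' : 𝒪[v.adicCompletion K] := ⟨x, hx1.le⟩
  let z : 𝒪[v.adicCompletion K] := ⟨ϖ * y ^ 2, hlt.le⟩
  have hz : IsLocalRing.residue 𝒪[v.adicCompletion K] z = 0 := by
    rw [IsLocalRing.residue_eq_zero_iff]
    exact (mem_maximalIdeal_integer_iff K v z).2 hlt
  have heq : ε * x' ^ 2 = 1 - z := by
    apply Subtype.ext
    change (ε : v.adicCompletion K) * x ^ 2 = 1 - ϖ * y ^ 2
    linear_combination hxy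
  have hres := congr_arg (IsLocalRing.residue 𝒪[v.adicCompletion K]) heq
  rw [map_mul, map_pow, map_sub, map_one, hz, sub_zero] at hres
  apply hε
  -- `ε̄ = (x̄⁻¹)²`
  have hx'0 : IsLocalRing.residue 𝒪[v.adicCompletion K] x' ≠ 0 := by
    intro h0
    rw [h0, zero_pow two_ne_zero, mul_zero] at hres
    exact zero_ne_one hres
  refine ⟨(IsLocalRing.residue 𝒪[v.adicCompletion K] x')⁻¹, ?_⟩
  field_simp
  linear_combination hres

/-! ### O'Meara 63:13 at a non-dyadic place -/

/-- At a place `v` not above `2`, `2` is a unit of `𝒪_v`. [folklore] -/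
theorem isUnit_two_integer_of_not_mem (h2 : (2 : 𝓞 K) ∉ v.asIdeal) :
    IsUnit (2 : 𝒪[v.adicCompletion K]) := by
  rw [isUnit_integer_iff]
  have h : ((2 : 𝒪[v.adicCompletion K]) : v.adicCompletion K) =
      algebraMap K (v.adicCompletion K) (algebraMap (𝓞 K) K 2) := by
    rw [map_ofNat, map_ofNat]; rfl
  have hval : ∀ c : K, Valued.v (algebraMap K (v.adicCompletion K) c) = v.valuation K c :=
    fun c ↦ HeightOneSpectrum.valuedAdicCompletion_eq_valuation' v c
  rw [h, hval]
  exact v.valuation_eq_one_iff_notMem.2 h2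

/-- If `2` is a unit of `𝒪_v`, the residue field `𝓀_v` has characteristic `≠ 2`. [folklore] -/
theorem ringChar_residueField_ne_two (h2 : IsUnit (2 : 𝒪[v.adicCompletion K])) :
    ringChar 𝓀[v.adicCompletion K] ≠ 2 := by
  intro h
  have h0 : ((2 : ℕ) : 𝓀[v.adicCompletion K]) = 0 := (ringChar.spec _ 2).2 (h ▸ dvd_rfl)
  have h2' : IsUnit (IsLocalRing.residue 𝒪[v.adicCompletion K] 2) := h2.map _
  rw [map_ofNat] at h2'
  exact h2'.ne_zero (by exact_mod_cast h0)

/-- At a place `v` not above `2`, the residue field `𝓀_v` has characteristic `≠ 2` and hence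
contains a non-square (Mathlib `FiniteField.exists_nonsquare`; `𝓀_v` is finite,
`Literature.NumberTheory.Automorphic.finite_residueField_adicCompletion`), which lifts to a unit `Δ ∈ 𝒪_v` of
non-square residue. [folklore] -/
theorem exists_not_isSquare_residue (h2 : (2 : 𝓞 K) ∉ v.asIdeal) :
    ∃ Δ : 𝒪[v.adicCompletion K], ¬ IsSquare (IsLocalRing.residue 𝒪[v.adicCompletion K] Δ) := by
  haveI := Literature.NumberTheory.Automorphic.finite_residueField_adicCompletion K v
  obtain ⟨δ, hδ⟩ := FiniteField.exists_nonsquare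
    (ringChar_residueField_ne_two K v (isUnit_two_integer_of_not_mem K v h2))
  obtain ⟨Δ, rfl⟩ := IsLocalRing.residue_surjective δ
  exact ⟨Δ, hδ⟩

/-- **O'Meara 63:13 at a non-dyadic place.** Let `v` be a finite place of the number field `K`
not above `2` and `β ∈ K_vˣ` a non-square. Then some `α ∈ K_vˣ` has `(α, β)_v = -1`: if `v(β)` is
odd take for `α` a unit `Δ` of non-square residue (`(Δ, β)_v = -1` by the tame computation); if
`v(β)` is even, `β = u c²` with `u` a unit, necessarily of non-square residue (Hensel), and
`α = π` a uniformiser works (`(π, β)_v = (π, u)_v = (u, π)_v = -1`). This is the non-dyadic case of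
the named fact `adicCompletion_exists_hilbertSymbol_eq_neg_one` (O'Meara's proof: "if `β` is a
prime element take `α = Δ` … take `α = π`"). [cite: Omeara1963, §63B Prop. 63:13] -/
theorem adicCompletion_exists_hilbertSymbol_eq_neg_one_of_not_mem (h2 : (2 : 𝓞 K) ∉ v.asIdeal)
    (β : v.adicCompletion K) (hβ0 : β ≠ 0) (hβ : ¬ IsSquare β) :
    ∃ α : v.adicCompletion K, α ≠ 0 ∧ hilbertSymbol (v.adicCompletion K) α β = -1 := by
  obtain ⟨Δ, hΔ⟩ := exists_not_isSquare_residue K v h2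
  have hΔu : IsUnit Δ := by
    by_contra h
    apply hΔ
    have h0 : IsLocalRing.residue 𝒪[v.adicCompletion K] Δ = 0 := by
      rw [IsLocalRing.residue_eq_zero_iff, IsLocalRing.mem_maximalIdeal, mem_nonunits_iff]
      exact h
    rw [h0]
    exact IsSquare.zero
  have hΔ0 : (Δ : v.adicCompletion K) ≠ 0 := by
    intro h0
    have h1 := (isUnit_integer_iff K v Δ).1 hΔu
    rw [h0, map_zero] at h1
    exact zero_ne_one h1
  rcases Int.even_or_odd (WithZero.log (Valued.v β)) with ⟨n, hn⟩ | hodd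
  · -- even valuation `2n`: normalise `β` to a unit `u = β c²`, `c = ϖⁿ`, `ϖ` a uniformiser
    obtain ⟨π, hπ⟩ := v.valuation_exists_uniformizer K
    have hval : ∀ c : K, Valued.v (algebraMap K (v.adicCompletion K) c) = v.valuation K c :=
      fun c ↦ HeightOneSpectrum.valuedAdicCompletion_eq_valuation' v c
    set ϖ : v.adicCompletion K := algebraMap K _ π with hϖdef
    have hϖ : Valued.v ϖ = WithZero.exp (-1) := by rw [hϖdef, hval, hπ]
    have hvϖ : Valued.v ϖ ≠ 0 := by rw [hϖ]; exact WithZero.exp_ne_zero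
    have hϖ0 : ϖ ≠ 0 := (Valuation.ne_zero_iff Valued.v).1 hvϖ
    set c : v.adicCompletion K := ϖ ^ n with hcdef
    have hc0 : c ≠ 0 := zpow_ne_zero _ hϖ0
    have hvc0 : Valued.v c ≠ 0 := (Valuation.ne_zero_iff Valued.v).2 hc0
    have hvc : WithZero.log (Valued.v c) = -n := by
      rw [hcdef, map_zpow₀, WithZero.log_zpow, hϖ, WithZero.log_exp, smul_eq_mul, mul_neg_one]
    set u : v.adicCompletion K := β * c ^ 2 with hudef
    have hvβ : Valued.v β ≠ 0 := (Valuation.ne_zero_iff Valued.v).2 hβ0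
    have hu1 : Valued.v u = 1 := by
      have hvc2 : Valued.v (c ^ 2) ≠ 0 := (Valuation.ne_zero_iff Valued.v).2 (pow_ne_zero 2 hc0)
      have hu0 : Valued.v u ≠ 0 := by
        rw [hudef, map_mul]
        exact mul_ne_zero hvβ hvc2
      have hl : WithZero.log (Valued.v u) = 0 := by
        rw [hudef, map_mul, WithZero.log_mul hvβ hvc2, log_valuation_sq, hvc, hn]
        ring
      rw [← WithZero.exp_log hu0, hl, WithZero.exp_zero]
    have hβu : β = u * c⁻¹ ^ 2 := by
      rw [hudef]
      field_simp
    let u' : 𝒪[v.adicCompletion K] := ⟨u, hu1.le⟩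
    have hu'u : IsUnit u' := (isUnit_integer_iff K v u').2 hu1
    -- `u` is not a square in `K_v` (else `β = u c⁻²` would be)
    have husq : ¬ IsSquare u := by
      rintro ⟨z, hz⟩
      exact hβ ⟨z * c⁻¹, by rw [hβu, hz]; ring⟩
    -- hence its residue is not a square (Hensel)
    have hres : ¬ IsSquare (IsLocalRing.residue 𝒪[v.adicCompletion K] u') := fun h ↦ by
      obtain ⟨r, hr⟩ := isSquare_of_isSquare_residue K v (isUnit_two_integer_of_not_mem K v h2)
        hu'u h
      exact husq ⟨r, congr_arg Subtype.val hr⟩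
    -- `(ϖ, β) = (ϖ, u c⁻²) = (ϖ, u) = (u, ϖ) = -1`
    refine ⟨ϖ, hϖ0, ?_⟩
    have hu : hilbertSymbol (v.adicCompletion K) u ϖ = -1 :=
      hilbertSymbol_eq_neg_one_of_not_isSquare_residue_of_odd K v hres
        (by rw [hϖ, WithZero.log_exp]; exact ⟨-1, by norm_num⟩)
    rw [hilbertSymbol_eq_neg_one_iff] at hu ⊢
    rintro ⟨x, y, hxy⟩
    -- `ϖ x² + (u c⁻²) y² = 1` gives `u (y/c)² + ϖ x² = 1`
    exact hu ⟨y * c⁻¹, x, by rw [hβu] at hxy; linear_combination hxy⟩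
  · -- odd valuation: `α = Δ`
    exact ⟨Δ, hΔ0, hilbertSymbol_eq_neg_one_of_not_isSquare_residue_of_odd K v hΔ hodd⟩

/-! ### Local units at a non-dyadic place have trivial Hilbert symbol -/

open Polynomial in
/-- Over a finite field of odd characteristic, `a x² + b y² = 1` is soluble for `a b ≠ 0`
(pigeonhole: the `(q+1)/2` values of `a x²` meet the `(q+1)/2` values of `1 - b y²`; Mathlib
`FiniteField.exists_root_sum_quadratic`). [folklore] -/
theorem FiniteField.exists_mul_sq_add_mul_sq_eq_one {k : Type*} [Field k] [Finite k]
    (hchar : ringChar k ≠ 2) {a b : k} (ha : a ≠ 0) (hb : b ≠ 0) :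
    ∃ x y : k, a * x ^ 2 + b * y ^ 2 = 1 := by
  haveI := Fintype.ofFinite k
  have hf : (C a * X ^ 2 : k[X]).degree = 2 := degree_C_mul_X_pow 2 ha
  have hg : (C b * X ^ 2 - 1 : k[X]).degree = 2 := by
    rw [degree_sub_eq_left_of_degree_lt] <;> rw [degree_C_mul_X_pow 2 hb]
    · norm_num
    · rw [degree_one]
      norm_num
  obtain ⟨x, y, h⟩ := FiniteField.exists_root_sum_quadratic hf hg
    (FiniteField.odd_card_of_char_ne_two hchar)
  refine ⟨x, y, ?_⟩
  simp only [eval_mul, eval_C, eval_pow, eval_X, eval_sub, eval_one] at h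
  linear_combination h

/-- **Units have trivial Hilbert symbol at a non-dyadic place**: if `2 ∈ 𝒪_vˣ` and
`u₁ u₂ ∈ 𝒪_vˣ` then `(u₁, u₂)_v = 1` — solve `ū₁ x² + ū₂ y² = 1` in the finite residue field and
lift with Hensel's lemma for squares (O'Meara 62:1, and Example 63:12: "let `ε, δ` be units in a
given non-dyadic local field; then `(ε, δ)_𝔭 = 1` always"; Serre, *Cours d'arithmétique*,
III §1.2). [cite: Omeara1963, §63B Example 63:12] -/
theorem hilbertSymbol_eq_one_of_isUnit (h2 : IsUnit (2 : 𝒪[v.adicCompletion K]))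
    {u₁ u₂ : 𝒪[v.adicCompletion K]} (hu₁ : IsUnit u₁) (hu₂ : IsUnit u₂) :
    hilbertSymbol (v.adicCompletion K) (u₁ : v.adicCompletion K) (u₂ : v.adicCompletion K) = 1 := by
  haveI := Literature.NumberTheory.Automorphic.finite_residueField_adicCompletion K v
  have hres0 : ∀ {u : 𝒪[v.adicCompletion K]}, IsUnit u →
      IsLocalRing.residue 𝒪[v.adicCompletion K] u ≠ 0 := fun hu h0 ↦ by
    rw [IsLocalRing.residue_eq_zero_iff, IsLocalRing.mem_maximalIdeal, mem_nonunits_iff] at h0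
    exact h0 hu
  obtain ⟨x₀, y₀, hxy⟩ := FiniteField.exists_mul_sq_add_mul_sq_eq_one
    (ringChar_residueField_ne_two K v h2) (hres0 hu₁) (hres0 hu₂)
  obtain ⟨Y, rfl⟩ := IsLocalRing.residue_surjective y₀
  rw [hilbertSymbol_eq_one_iff]
  set U₁ := hu₁.unit with hU₁
  set U₂ := hu₂.unit with hU₂
  by_cases hx₀ : x₀ = 0
  · -- `ū₂ ȳ₀² = 1`: then `u₂⁻¹` has square residue, so `u₂⁻¹ = Z²` and `u₂ Z² = 1`
    subst hx₀
    have hxy' : IsLocalRing.residue 𝒪[v.adicCompletion K] u₂ *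
        IsLocalRing.residue 𝒪[v.adicCompletion K] Y ^ 2 = 1 := by
      linear_combination hxy
    have hsq : IsSquare
        (IsLocalRing.residue 𝒪[v.adicCompletion K] (↑U₂⁻¹ : 𝒪[v.adicCompletion K])) := by
      refine ⟨IsLocalRing.residue 𝒪[v.adicCompletion K] Y, ?_⟩
      rw [map_units_inv, IsUnit.unit_spec, ← sq]
      exact inv_eq_of_mul_eq_one_right hxy'
    obtain ⟨Z, hZ⟩ := isSquare_of_isSquare_residue K v h2 (Units.isUnit U₂⁻¹) hsq
    refine ⟨0, (Z : v.adicCompletion K), ?_⟩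
    have h1 : u₂ * (↑U₂⁻¹ : 𝒪[v.adicCompletion K]) = 1 := by
      rw [← IsUnit.unit_spec hu₂]
      exact U₂.mul_inv
    have h1' := congr_arg (Subtype.val : 𝒪[v.adicCompletion K] → v.adicCompletion K) h1
    rw [hZ] at h1'
    push_cast at h1'
    linear_combination h1'
  · -- `w := u₁⁻¹ (1 - u₂ Y²)` is a unit with residue `x₀²`, hence a square `X²`
    set w : 𝒪[v.adicCompletion K] := ↑U₁⁻¹ * (1 - u₂ * Y ^ 2) with hw
    have hwres : IsLocalRing.residue 𝒪[v.adicCompletion K] w = x₀ ^ 2 := by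
      rw [hw, map_mul, map_units_inv, IsUnit.unit_spec, map_sub, map_one, map_mul, map_pow,
        show (1 : 𝓀[v.adicCompletion K]) - IsLocalRing.residue 𝒪[v.adicCompletion K] u₂ *
            IsLocalRing.residue 𝒪[v.adicCompletion K] Y ^ 2 =
          IsLocalRing.residue 𝒪[v.adicCompletion K] u₁ * x₀ ^ 2 by linear_combination -hxy,
        inv_mul_cancel_left₀ (hres0 hu₁)]
    have hwu : IsUnit w := by
      by_contra h
      have h0 : IsLocalRing.residue 𝒪[v.adicCompletion K] w = 0 := by
        rw [IsLocalRing.residue_eq_zero_iff, IsLocalRing.mem_maximalIdeal, mem_nonunits_iff]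
        exact h
      rw [hwres] at h0
      exact hx₀ (pow_eq_zero_iff two_ne_zero |>.1 h0)
    obtain ⟨X, hX⟩ := isSquare_of_isSquare_residue K v h2 hwu ⟨x₀, by rw [hwres, sq]⟩
    refine ⟨(X : v.adicCompletion K), (Y : v.adicCompletion K), ?_⟩
    have h1 : u₁ * w = 1 - u₂ * Y ^ 2 := by
      rw [hw, ← mul_assoc, ← IsUnit.unit_spec hu₁, U₁.mul_inv, one_mul]
    have h1' := congr_arg (Subtype.val : 𝒪[v.adicCompletion K] → v.adicCompletion K) h1
    rw [hX] at h1'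
    push_cast at h1'
    linear_combination h1'

end Literature.NumberTheory.QuadraticForms
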